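import Mathlib
import Literature.MathematicalPhysics.QuantumFieldTheory.IsingGaugeRandomCurrents
import HarnessLib

/-!
# The switching lemma for the random-current representation of Ising (`ℤ₂`) lattice gauge theory
# (Forsström–Viklund 2025, Lemma 1.2) — PROVED on the finite torus

Companion of `IsingGaugeRandomCurrents` (Theorem 1.1 there: the current expansion
`Z_β[γ] = |Ω¹| Σ_{n ∈ 𝒞_γ} w(n)` of Wilson-loop numerators of Ising lattice gauge theory by plaquette
CURRENTS `n : {plaquettes} → ℤ_{≥0}` with edge sources, `𝒞_γ = {n : ∂(n mod 2) = γ}`,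
`w(n) = ∏_p (2β)^{n(p)}/n(p)!`; that file's docstring lists the switching lemma as NOT typed — this
file supplies it).

* M. P. Forsström, F. Viklund, *Current expansion and couplings for Ising lattice gauge theory*,
  arXiv:2502.19942 [ForsstromViklund2025currents], **Lemma 1.2 (switching lemma)**
  [corpus:paper:arxiv-2502.19942 p0004 L23] and its proof, §4 [p0008]: for `F : 𝒞 → ℂ` and loops
  `γ₁, γ₂`, `Σ_{n₁∈𝒞_{γ₁}, n₂∈𝒞_{γ₂}} F(n₁+n₂) w(n₁)w(n₂) =
  Σ_{n₁∈𝒞_0, n₂∈𝒞_{γ₁+γ₂}} F(n₁+n₂) w(n₁)w(n₂) 𝟙(∃ q ∈ 𝒞_{γ₂} : q ≤ n₁+n₂)`; proof: (4.1)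
  `binom(n₁+n₂, n₁) w(n₁+n₂) = w(n₁)w(n₂)`, regroup by `n = n₁ + n₂`, and the combinatorial core
  ("eq. goal") `Σ_{n₁∈𝒞_{γ₁}, n₁≤n} binom(n,n₁) = 𝟙(∃ q∈𝒞_{γ₁}, q≤n) Σ_{n₁∈𝒞_0, n₁≤n} binom(n,n₁)`,
  proved by encoding `m ≤ n` as sequences of subsets `S_p ⊆ {1,…,n(p)}` and switching
  `(S_p) ↦ (S_p ∆ S^q_p)`.

## Scope (read this first)

Gauge group `ℤ₂` only; finite torus `𝕋^d_L` (reading R1 of the companion: the source works on a box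
with free boundary; the algebra is local). Nothing here bears on the Yang–Mills mass gap or on
`BalabanLadder.IR`; in the `ym` ladder only the conditional finite-`𝕋⁴` rung `BalabanLadder.UV` is
closed by any route. Typed for the `ym-ir` census row on random currents ("no switching-lemma
analogue for `SU(N)` exists in print" — here is the `ℤ₂` one, proved).

## What is typed (transcriber's form, flagged)

* `binomCurrent n m = ∏_p C(n(p), m(p))`, `below n = {m ≤ n}`, `SubCurrent n` (sequences of subsets
  `S_p ⊆ Fin (n p)`), `profile`, `sum_binomCurrent_eq_card` ("`m ↦ 𝒮_m` is bijective,
  `|𝒮_m| = binom(n,m)`"), `bd₂_profile_symmDiff` (the switch shifts the source by `∂q`),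
  **`switching_core`** (the combinatorial core, eq. "goal" of §4);
* `currentWeight_mul_currentWeight_sub` (eq. (4.1)), `isSourceOf_sub_iff` (sources add),
  **`switching_fiber`** — Lemma 1.2 fibre by fibre (`n₁ + n₂ = n` fixed), valid for every real `β`
  with no convergence issue;
* `tsum_pair_eq_tsum_fiber` (re-indexing absolutely convergent double series by `n = n₁ + n₂`),
  `summable_switch`, and **`switching_lemma`** — Lemma 1.2 as printed, as an identity of absolutely
  convergent series over `𝒞 × 𝒞`, for `β ≥ 0` and BOUNDED real `F` (the source takes
  `F : 𝒞 → ℂ` without comment on convergence; all its applications use indicators). The indicator is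
  the one of the printed PROOF, `∃ q ∈ 𝒞_{γ₁}, q ≤ n₁+n₂`; the printed STATEMENT carries `𝒞_{γ₂}` —
  the two versions are equivalent by the symmetry `γ₁ ↔ γ₂` of the left-hand side (transcriber's
  remark; we type the proof's version);
* application [ForsstromViklund2025currents, **Prop. 6.1**]: `tsum_mul_tsum_currents` and
  **`wilson_sq_eq_doubleCurrent`** — `𝔼_β[W_γ]² = (Z_β[γ]/Z_β[0])² =
  Σ_{n₁,n₂∈𝒞_0} w(n₁)w(n₂)𝟙(∃q∈𝒞_γ: q ≤ n₁+n₂) / Σ_{n₁,n₂∈𝒞_0} w(n₁)w(n₂)` (`β ≥ 0`), by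
  Theorem 1.1 of the companion file twice and the switching lemma with `F = 1`;
* applications [ForsstromViklund2025currents, **Props. 6.2, 6.3**] by the printed random-current
  route: `loopNumerator_nonneg` (`Z_β[γ] ≥ 0`), `loopNumerator_zero_pos`, **`loopNumerator_mul_le`**
  (`Z_β[γ₁] Z_β[γ₂] ≤ Z_β[0] Z_β[γ₁+γ₂]`: the switched series is the unswitched one times an
  indicator) and **`wilsonExpect_mul_le`** (Griffiths II: `𝔼_β[W_{γ₁}] 𝔼_β[W_{γ₂}] ≤ 𝔼_β[W_{γ₁+γ₂}]`,
  `β ≥ 0`). (The same inequality for `q`-state Potts gauge theory, `q` prime, by the FK route: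
  `PlaquetteRC.pottsExpect_wilsonLoopVar_mul_ge` in `PottsGaugeWilsonLoopMonotonicity`.)

Everything in this file is PROVED; no named fact is introduced.
-/

open Finset
open scoped symmDiff

namespace Literature.MathematicalPhysics.QuantumFieldTheory

namespace IsingGaugeCurrents

open LatticeForm PlaquetteRC

variable {d L : ℕ} [NeZero L]

/-! ### Multiset subsets of a current and their profiles -/

/-- The product binomial coefficient `binom(n; m) = ∏_p C(n(p), m(p))`: the number of sub-multisets
of the current `n` (a multiset of plaquettes) with multiplicity profile `m`.
[cite: ForsstromViklund2025currents, §4 proof of Lemma 1.2 (binom(n₁+n₂, n₁), the sets 𝒮_m)] -/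
def binomCurrent (n m : Current d L) : ℕ := ∏ p : Plaquette d L, (n p).choose (m p)

/-- The currents `m ≤ n` (pointwise), as a finset. [cite: ForsstromViklund2025currents, §4 proof of Lemma 1.2] -/
def below (n : Current d L) : Finset (Current d L) := Fintype.piFinset fun p => Finset.range (n p + 1)

/-- Membership in `below n`. [cite: ForsstromViklund2025currents, §4] -/
theorem mem_below {n m : Current d L} : m ∈ below n ↔ m ≤ n := by
  simp only [below, Fintype.mem_piFinset, Finset.mem_range, Nat.lt_succ_iff]
  rfl

/-- A sub-multiset of the current `n`: for every plaquette `p` a subset `S_p ⊆ {1, …, n(p)}` (the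
sequences `(S_p)` of the printed proof). [cite: ForsstromViklund2025currents, §4 proof of Lemma 1.2 (𝒮_m)] -/
abbrev SubCurrent (n : Current d L) : Type := (p : Plaquette d L) → Finset (Fin (n p))

/-- The multiplicity profile `m(p) = |S_p|` of a sub-multiset. [cite: ForsstromViklund2025currents, §4 proof of Lemma 1.2] -/
def profile {n : Current d L} (S : SubCurrent n) : Current d L := fun p => (S p).card

/-- **Counting sub-multisets by profile**: `Σ_{m ≤ n, P(m)} binom(n; m) = #{S : P(profile S)}`
("the mapping `m ↦ 𝒮_m` is clearly bijective", `|𝒮_m| = binom(n; m)`).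
[cite: ForsstromViklund2025currents, §4 proof of Lemma 1.2] -/
theorem sum_binomCurrent_eq_card (n : Current d L) (P : Current d L → Prop) [DecidablePred P] :
    (∑ m ∈ below n, if P m then binomCurrent n m else 0) =
      (Finset.univ.filter fun S : SubCurrent n => P (profile S)).card := by
  classical
  rw [Finset.card_eq_sum_ones, Finset.sum_filter]
  rw [← Finset.sum_fiberwise_of_maps_to (s := (Finset.univ : Finset (SubCurrent n))) (t := below n)
    (g := profile) (fun S _ => mem_below.mpr fun p => by
      simpa [profile] using (S p).card_le_univ)]
  refine Finset.sum_congr rfl fun m _ => ?_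
  by_cases hP : P m
  · rw [if_pos hP]
    have hfib : (Finset.univ.filter fun S : SubCurrent n => profile S = m) =
        Fintype.piFinset fun p => Finset.powersetCard (m p) (Finset.univ : Finset (Fin (n p))) := by
      ext S
      simp only [Finset.mem_filter, Finset.mem_univ, true_and, Fintype.mem_piFinset,
        Finset.mem_powersetCard, Finset.subset_univ, profile, funext_iff]
    rw [Finset.sum_congr rfl (fun S hS => if_pos (by rw [(Finset.mem_filter.mp hS).2]; exact hP)),
      ← Finset.card_eq_sum_ones, hfib, Fintype.card_piFinset]
    refine Finset.prod_congr rfl fun p _ => ?_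
    rw [Finset.card_powersetCard, Finset.card_univ, Fintype.card_fin]
  · rw [if_neg hP]
    symm
    refine Finset.sum_eq_zero fun S hS => ?_
    rw [(Finset.mem_filter.mp hS).2, if_neg hP]

/-- Parity of a symmetric difference: `|A ∆ B| ≡ |A| + |B| (mod 2)`. [folklore] -/
private theorem card_symmDiff_modTwo {α : Type*} [DecidableEq α] (s t : Finset α) :
    (((s ∆ t).card : ℕ) : ZMod 2) = (s.card : ZMod 2) + (t.card : ZMod 2) := by
  have h1 : (s ∆ t).card = (s \ t).card + (t \ s).card := by
    rw [symmDiff_def, Finset.sup_eq_union, Finset.card_union_of_disjoint disjoint_sdiff_sdiff]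
  have h2 := Finset.card_sdiff_add_card_inter s t
  have h3 := Finset.card_sdiff_add_card_inter t s
  rw [Finset.inter_comm] at h3
  have h4 : (s ∆ t).card + 2 * (s ∩ t).card = s.card + t.card := by omega
  have h5 := congrArg (Nat.cast : ℕ → ZMod 2) h4
  push_cast at h5
  have h22 : (2 : ZMod 2) = 0 := by decide
  rw [h22, zero_mul, add_zero] at h5
  exact h5

/-- **The switching involution** `(S_p) ↦ (S_p ∆ S^q_p)` shifts the source of the profile by `∂q`:
`∂(profile(S ∆ S^q)) = ∂(profile S) + ∂(profile S^q)` in `C₁(𝕋; ℤ₂)`.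
[cite: ForsstromViklund2025currents, §4 proof of Lemma 1.2 (the map τ)] -/
theorem bd₂_profile_symmDiff {n : Current d L} (S T : SubCurrent n) :
    bd₂ (fun p => ((profile (fun p => S p ∆ T p) p : ℕ) : ZMod 2)) =
      bd₂ (fun p => ((profile S p : ℕ) : ZMod 2)) + bd₂ (fun p => ((profile T p : ℕ) : ZMod 2)) := by
  have h : (fun p => ((profile (fun p => S p ∆ T p) p : ℕ) : ZMod 2)) =
      (fun p => ((profile S p : ℕ) : ZMod 2)) + fun p => ((profile T p : ℕ) : ZMod 2) := by
    funext p
    simp only [profile, Pi.add_apply, card_symmDiff_modTwo]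
  rw [h]
  funext x k
  simp only [bd₂, Pi.add_apply, add_mul, Finset.sum_add_distrib]

/-- **The combinatorial core of the switching lemma** (eq. (4.4) of the printed proof): for every
current `n` and every source `γ₁`,
`Σ_{m ≤ n, m ∈ 𝒞_{γ₁}} binom(n; m) = 𝟙[∃ q ≤ n, q ∈ 𝒞_{γ₁}] · Σ_{m ≤ n, m ∈ 𝒞_0} binom(n; m)`
(`q ≤ n` pointwise, i.e. `q ∈ below n`).
Proof as printed: count sub-multisets by profile and switch by `S ↦ S ∆ S^q`.
[cite: ForsstromViklund2025currents, Lemma 1.2 (proof, §4 eq. "goal")] -/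
theorem switching_core (n : Current d L) (γ₁ : Site d L → Fin d → ZMod 2) :
    (∑ m ∈ below n, if IsSourceOf γ₁ m then binomCurrent n m else 0) =
      if ∃ q ∈ below n, IsSourceOf γ₁ q then
        ∑ m ∈ below n, if IsSourceOf 0 m then binomCurrent n m else 0
      else 0 := by
  classical
  split_ifs with hq
  · obtain ⟨q, hqb, hq⟩ := hq
    have hqn : q ≤ n := mem_below.mp hqb
    rw [sum_binomCurrent_eq_card, sum_binomCurrent_eq_card]
    -- the fixed sub-multiset `S^q` with profile `q`
    let Sq : SubCurrent n := fun p => Finset.univ.filter fun i : Fin (n p) => (i : ℕ) < q p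
    have hSq : profile Sq = q := by
      funext p
      simp only [profile, Sq]
      rw [show (Finset.univ.filter fun i : Fin (n p) => (i : ℕ) < q p) =
        (Finset.range (q p)).attachFin (fun i hi => lt_of_lt_of_le (Finset.mem_range.mp hi) (hqn p))
        from by ext i; simp [Finset.mem_attachFin]]
      rw [Finset.card_attachFin, Finset.card_range]
    have hqsrc : bd₂ (fun p => ((profile Sq p : ℕ) : ZMod 2)) = γ₁ := by rw [hSq]; exact hq
    -- the involution
    refine Finset.card_bij (fun S _ => fun p => S p ∆ Sq p) ?_ ?_ ?_
    · intro S hS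
      rw [Finset.mem_filter] at hS ⊢
      refine ⟨Finset.mem_univ _, ?_⟩
      have h := bd₂_profile_symmDiff S Sq
      unfold IsSourceOf at hS ⊢
      rw [h, hS.2, hqsrc]
      funext x k
      rw [Pi.add_apply, Pi.add_apply, Pi.zero_apply, Pi.zero_apply]
      exact (by decide : ∀ a : ZMod 2, a + a = 0) _
    · intro S _ S' _ h
      funext p
      have := congrFun h p
      simpa using congrArg (· ∆ Sq p) this
    · intro T hT
      rw [Finset.mem_filter] at hT
      refine ⟨fun p => T p ∆ Sq p, ?_, ?_⟩
      · rw [Finset.mem_filter]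
        refine ⟨Finset.mem_univ _, ?_⟩
        have h := bd₂_profile_symmDiff T Sq
        unfold IsSourceOf at hT ⊢
        rw [h, hT.2, hqsrc, zero_add]
      · funext p
        simp [symmDiff_symmDiff_cancel_right]
  · refine Finset.sum_eq_zero fun m hm => ?_
    rw [if_neg]
    exact fun hsrc => hq ⟨m, hm, hsrc⟩

/-! ### Weights: `w(n₁) w(n₂) = binom(n₁ + n₂; n₁) w(n₁ + n₂)` -/

/-- **The weight identity** `binom(n; m) w(n) = w(m) w(n - m)` for `m ≤ n`
(eq. (4.1) of the printed proof: `binom(n₁+n₂, n₁) w(n₁+n₂) = w(n₁) w(n₂)`).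
[cite: ForsstromViklund2025currents, §4 proof of Lemma 1.2 (eq. (4.1))] -/
theorem currentWeight_mul_currentWeight_sub (β : ℝ) {n m : Current d L} (h : m ≤ n) :
    currentWeight β m * currentWeight β (n - m) = binomCurrent n m * currentWeight β n := by
  unfold currentWeight binomCurrent
  rw [Nat.cast_prod, ← Finset.prod_mul_distrib, ← Finset.prod_mul_distrib]
  refine Finset.prod_congr rfl fun p _ => ?_
  obtain ⟨b, hb⟩ := Nat.exists_eq_add_of_le (h p)
  rw [Pi.sub_apply, hb, Nat.add_sub_cancel_left]
  have hchoose : (m p + b).choose (m p) = (m p + b).choose b := by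
    rw [Nat.choose_symm_add]
  have hfac : (((m p + b).factorial : ℕ) : ℝ) =
      ((m p + b).choose (m p) : ℝ) * ((m p).factorial : ℝ) * (b.factorial : ℝ) := by
    rw [hchoose]
    exact_mod_cast (Nat.add_choose_mul_factorial_mul_factorial (m p) b).symm
  have h1 : ((m p).factorial : ℝ) ≠ 0 := by positivity
  have h2 : (b.factorial : ℝ) ≠ 0 := by positivity
  have h3 : (((m p + b).choose (m p) : ℕ) : ℝ) ≠ 0 := by
    exact_mod_cast (Nat.choose_pos (Nat.le_add_right _ _)).ne'
  rw [hfac, pow_add]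
  field_simp

/-- `∂` of a difference of currents (`m ≤ n`): `∂((n - m) mod 2) = ∂(n mod 2) - ∂(m mod 2)`.
[cite: ForsstromViklund2025currents, §4 proof of Lemma 1.2 (n = n₁ + n₂)] -/
theorem bd₂_natCast_sub {n m : Current d L} (h : m ≤ n) :
    bd₂ (fun p => (((n - m) p : ℕ) : ZMod 2)) =
      bd₂ (fun p => ((n p : ℕ) : ZMod 2)) - bd₂ (fun p => ((m p : ℕ) : ZMod 2)) := by
  have hfun : (fun p => (((n - m) p : ℕ) : ZMod 2)) =
      (fun p => ((n p : ℕ) : ZMod 2)) - fun p => ((m p : ℕ) : ZMod 2) := by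
    funext p
    rw [Pi.sub_apply, Pi.sub_apply, Nat.cast_sub (h p)]
  rw [hfun]
  funext x k
  simp only [bd₂, Pi.sub_apply, sub_mul, Finset.sum_sub_distrib]

/-- Sources add up: for `m ≤ n`, `n - m ∈ 𝒞_γ ↔ ∂(n mod 2) = ∂(m mod 2) + γ`.
[cite: ForsstromViklund2025currents, §4 proof of Lemma 1.2] -/
theorem isSourceOf_sub_iff {n m : Current d L} (h : m ≤ n) (γ : Site d L → Fin d → ZMod 2) :
    IsSourceOf γ (n - m) ↔
      bd₂ (fun p => ((n p : ℕ) : ZMod 2)) = bd₂ (fun p => ((m p : ℕ) : ZMod 2)) + γ := by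
  unfold IsSourceOf
  rw [bd₂_natCast_sub h, sub_eq_iff_eq_add']

/-- **The switching lemma, fibre by fibre** (Forsström–Viklund Lemma 1.2 for plaquette currents on
`𝕋^d_L`): for every current `n` and sources `γ₁, γ₂`,
`Σ_{n₁+n₂=n, n₁∈𝒞_{γ₁}, n₂∈𝒞_{γ₂}} w(n₁)w(n₂)
  = 𝟙[∃ q ≤ n, q ∈ 𝒞_{γ₁}] · Σ_{n₁+n₂=n, n₁∈𝒞_0, n₂∈𝒞_{γ₁+γ₂}} w(n₁)w(n₂)`.
Multiplying by `F(n)` and summing over `n` (absolutely convergent for bounded `F`, since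
`Σ_n w(n) 2^{|n|} < ∞`) gives the printed statement
`Σ_{n₁∈𝒞_{γ₁}, n₂∈𝒞_{γ₂}} F(n₁+n₂)w(n₁)w(n₂) = Σ_{n₁∈𝒞_0, n₂∈𝒞_{γ₁+γ₂}} F(n₁+n₂)w(n₁)w(n₂)
𝟙[∃ q∈𝒞_{γ₁}: q ≤ n₁+n₂]` (the printed statement carries `𝒞_{γ₂}` in the indicator and the
printed proof `𝒞_{γ₁}`; by the symmetry `γ₁ ↔ γ₂` both hold — we type the proof's).
[cite: ForsstromViklund2025currents, Lemma 1.2 and §4 (proof)] -/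
theorem switching_fiber (β : ℝ) (γ₁ γ₂ : Site d L → Fin d → ZMod 2) (n : Current d L) :
    (∑ m ∈ below n, if IsSourceOf γ₁ m ∧ IsSourceOf γ₂ (n - m) then
        currentWeight β m * currentWeight β (n - m) else 0) =
      if ∃ q ∈ below n, IsSourceOf γ₁ q then
        ∑ m ∈ below n, if IsSourceOf 0 m ∧ IsSourceOf (γ₁ + γ₂) (n - m) then
          currentWeight β m * currentWeight β (n - m) else 0
      else 0 := by
  classical
  -- both sides reduce to `𝟙[n ∈ 𝒞_{γ₁+γ₂}] w(n) Σ binom`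
  have hL : (∑ m ∈ below n, if IsSourceOf γ₁ m ∧ IsSourceOf γ₂ (n - m) then
        currentWeight β m * currentWeight β (n - m) else 0) =
      if IsSourceOf (γ₁ + γ₂) n then
        currentWeight β n * ((∑ m ∈ below n, if IsSourceOf γ₁ m then binomCurrent n m else 0 : ℕ) : ℝ)
      else 0 := by
    rw [Nat.cast_sum, Finset.mul_sum]
    split_ifs with hS
    · refine Finset.sum_congr rfl fun m hm => ?_
      have hmn : m ≤ n := mem_below.mp hm
      by_cases h1 : IsSourceOf γ₁ m
      · have h2 : IsSourceOf γ₂ (n - m) := by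
          rw [isSourceOf_sub_iff hmn]
          unfold IsSourceOf at h1 hS
          rw [h1, hS]
        rw [if_pos ⟨h1, h2⟩, Nat.cast_ite, if_pos h1, currentWeight_mul_currentWeight_sub β hmn]
        ring
      · rw [if_neg (fun h => h1 h.1), Nat.cast_ite, if_neg h1, Nat.cast_zero, mul_zero]
    · refine Finset.sum_eq_zero fun m hm => ?_
      have hmn : m ≤ n := mem_below.mp hm
      rw [if_neg]
      rintro ⟨h1, h2⟩
      rw [isSourceOf_sub_iff hmn] at h2
      unfold IsSourceOf at h1 hS
      rw [h1] at h2
      exact hS h2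
  have hR : (∑ m ∈ below n, if IsSourceOf 0 m ∧ IsSourceOf (γ₁ + γ₂) (n - m) then
        currentWeight β m * currentWeight β (n - m) else 0) =
      if IsSourceOf (γ₁ + γ₂) n then
        currentWeight β n * ((∑ m ∈ below n, if IsSourceOf 0 m then binomCurrent n m else 0 : ℕ) : ℝ)
      else 0 := by
    rw [Nat.cast_sum, Finset.mul_sum]
    split_ifs with hS
    · refine Finset.sum_congr rfl fun m hm => ?_
      have hmn : m ≤ n := mem_below.mp hm
      by_cases h1 : IsSourceOf 0 m
      · have h2 : IsSourceOf (γ₁ + γ₂) (n - m) := by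
          rw [isSourceOf_sub_iff hmn]
          unfold IsSourceOf at h1 hS
          rw [h1, hS, zero_add]
        rw [if_pos ⟨h1, h2⟩, Nat.cast_ite, if_pos h1, currentWeight_mul_currentWeight_sub β hmn]
        ring
      · rw [if_neg (fun h => h1 h.1), Nat.cast_ite, if_neg h1, Nat.cast_zero, mul_zero]
    · refine Finset.sum_eq_zero fun m hm => ?_
      have hmn : m ≤ n := mem_below.mp hm
      rw [if_neg]
      rintro ⟨h1, h2⟩
      rw [isSourceOf_sub_iff hmn] at h2
      unfold IsSourceOf at h1 hS
      rw [h1, zero_add] at h2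
      exact hS h2
  rw [hL, hR, switching_core n γ₁]
  split_ifs <;> simp

/-! ### Summing over the fibres: the switching lemma as printed (bounded `F`, `β ≥ 0`) -/

/-- `w(n) ≥ 0` for `β ≥ 0`. [cite: ForsstromViklund2025currents, §1.2 eq. (1.2)] -/
theorem currentWeight_nonneg {β : ℝ} (hβ : 0 ≤ β) (n : Current d L) : 0 ≤ currentWeight β n := by
  unfold currentWeight
  exact Finset.prod_nonneg fun p _ => by positivity

/-- `Σ_n w(n) = e^{2β |C₂⁺|}` converges. [cite: ForsstromViklund2025currents, Thm. 1.1 (proof)] -/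
theorem summable_currentWeight (β : ℝ) : Summable (fun n : Current d L => currentWeight β n) := by
  have h := hasSum_prod_pow_div_factorial (Plaquette d L) (fun _ => 2 * β)
  exact h.summable

/-- **Re-indexing pairs of currents by their sum**: for a summable family `G` on pairs,
`Σ'_{(n₁,n₂)} G(n₁,n₂) = Σ'_n Σ_{m ≤ n} G(m, n - m)` (the first step of the printed proof,
"`Σ_{n₁,n₂} … = Σ_n Σ_{n₁+n₂=n} …`"). [cite: ForsstromViklund2025currents, §4 proof of Lemma 1.2 (eqs. (4.2)–(4.3))] -/
theorem tsum_pair_eq_tsum_fiber (G : Current d L × Current d L → ℝ) (hG : Summable G) :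
    ∑' nn : Current d L × Current d L, G nn =
      ∑' n : Current d L, ∑ m ∈ below n, G (m, n - m) := by
  classical
  -- `i (a, b) = (a + b, a)` is injective with image `{(n, m) : m ≤ n}`
  let i : Current d L × Current d L → Current d L × Current d L := fun ab => (ab.1 + ab.2, ab.1)
  have hi : Function.Injective i := by
    rintro ⟨a, b⟩ ⟨a', b'⟩ h
    simp only [i, Prod.mk.injEq] at h
    obtain ⟨h1, rfl⟩ := h
    exact Prod.ext rfl (add_left_cancel h1)
  let g : Current d L × Current d L → ℝ := fun nm => if nm.2 ≤ nm.1 then G (nm.2, nm.1 - nm.2) else 0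
  have hgi : g ∘ i = G := by
    funext ab
    obtain ⟨a, b⟩ := ab
    simp only [Function.comp_apply, g, i, le_add_iff_nonneg_right, zero_le, if_true,
      add_tsub_cancel_left]
  have hsupp : ∀ x ∉ Set.range i, g x = 0 := by
    rintro ⟨n, m⟩ hx
    simp only [g]
    rw [if_neg]
    intro hmn
    exact hx ⟨(m, n - m), by simp [i, add_tsub_cancel_of_le hmn]⟩
  have hg : Summable g := (hi.summable_iff hsupp).mp (by rw [hgi]; exact hG)
  have hfib : ∀ n : Current d L, ∀ m ∉ below n, g (n, m) = 0 := by
    intro n m hm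
    simp only [g]
    rw [if_neg (fun h => hm (mem_below.mpr h))]
  calc ∑' nn, G nn = ∑' nn, (g ∘ i) nn := by rw [hgi]
    _ = ∑' nm, g nm := hi.tsum_eq (fun x hx => by
        by_contra hx'
        exact hx (hsupp x hx'))
    _ = ∑' n, ∑' m, g (n, m) := hg.tsum_prod' (fun n => summable_of_ne_finset_zero (hfib n))
    _ = ∑' n, ∑ m ∈ below n, G (m, n - m) := by
        refine tsum_congr fun n => ?_
        rw [tsum_eq_sum (hfib n)]
        refine Finset.sum_congr rfl fun m hm => ?_
        simp only [g]
        rw [if_pos (mem_below.mp hm)]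

/-- Summability of the two sides of the switching lemma for bounded `F` and `β ≥ 0`
(`|𝟙[…] F(n₁+n₂) w(n₁) w(n₂)| ≤ M w(n₁) w(n₂)`). [cite: ForsstromViklund2025currents, Lemma 1.2] -/
theorem summable_switch {β : ℝ} (hβ : 0 ≤ β) (F : Current d L → ℝ) {M : ℝ} (hF : ∀ n, |F n| ≤ M)
    (P : Current d L × Current d L → Prop) [DecidablePred P] :
    Summable (fun nn : Current d L × Current d L =>
      if P nn then F (nn.1 + nn.2) * (currentWeight β nn.1 * currentWeight β nn.2) else 0) := by
  have hM : 0 ≤ M := (abs_nonneg _).trans (hF 0)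
  have hw : Summable (fun n : Current d L => ‖currentWeight β n‖) := by
    simpa [Real.norm_eq_abs, abs_of_nonneg (currentWeight_nonneg hβ _)] using
      summable_currentWeight (d := d) (L := L) β
  have hprod : Summable (fun nn : Current d L × Current d L =>
      M * (currentWeight β nn.1 * currentWeight β nn.2)) :=
    (summable_mul_of_summable_norm hw hw).mul_left M
  refine Summable.of_norm_bounded hprod fun nn => ?_
  have hww : 0 ≤ currentWeight β nn.1 * currentWeight β nn.2 :=
    mul_nonneg (currentWeight_nonneg hβ _) (currentWeight_nonneg hβ _)
  split_ifs
  · rw [Real.norm_eq_abs, abs_mul, abs_of_nonneg hww]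
    exact mul_le_mul_of_nonneg_right (hF _) hww
  · rw [norm_zero]; positivity

/-- **The switching lemma (Forsström–Viklund, Lemma 1.2) for plaquette random currents on `𝕋^d_L`,
PROVED** (for `β ≥ 0` and bounded `F : 𝒞 → ℝ`, which makes both sides absolutely convergent):
`Σ_{n₁∈𝒞_{γ₁}, n₂∈𝒞_{γ₂}} F(n₁+n₂) w(n₁) w(n₂)
  = Σ_{n₁∈𝒞_0, n₂∈𝒞_{γ₁+γ₂}} F(n₁+n₂) w(n₁) w(n₂) 𝟙[∃ q ∈ 𝒞_{γ₁} : q ≤ n₁+n₂]`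
(indicator as in the printed PROOF; the printed statement has `𝒞_{γ₂}`, equivalent by `γ₁ ↔ γ₂`).
[cite: ForsstromViklund2025currents, Lemma 1.2] -/
theorem switching_lemma {β : ℝ} (hβ : 0 ≤ β) (F : Current d L → ℝ) {M : ℝ} (hF : ∀ n, |F n| ≤ M)
    (γ₁ γ₂ : Site d L → Fin d → ZMod 2) :
    ∑' nn : Current d L × Current d L,
        (if IsSourceOf γ₁ nn.1 ∧ IsSourceOf γ₂ nn.2 then
          F (nn.1 + nn.2) * (currentWeight β nn.1 * currentWeight β nn.2) else 0) =
      ∑' nn : Current d L × Current d L,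
        (if IsSourceOf 0 nn.1 ∧ IsSourceOf (γ₁ + γ₂) nn.2 ∧
            (∃ q ∈ below (nn.1 + nn.2), IsSourceOf γ₁ q) then
          F (nn.1 + nn.2) * (currentWeight β nn.1 * currentWeight β nn.2) else 0) := by
  classical
  rw [tsum_pair_eq_tsum_fiber _ (summable_switch hβ F hF _),
    tsum_pair_eq_tsum_fiber _ (summable_switch hβ F hF _)]
  refine tsum_congr fun n => ?_
  -- on the fibre `n₁ + n₂ = n` both sides are `F(n) ×` the two sides of `switching_fiber`
  have hadd : ∀ m ∈ below n, m + (n - m) = n := fun m hm => add_tsub_cancel_of_le (mem_below.mp hm)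
  have hL : (∑ m ∈ below n, if IsSourceOf γ₁ m ∧ IsSourceOf γ₂ (n - m) then
        F (m + (n - m)) * (currentWeight β m * currentWeight β (n - m)) else 0) =
      F n * ∑ m ∈ below n, if IsSourceOf γ₁ m ∧ IsSourceOf γ₂ (n - m) then
        currentWeight β m * currentWeight β (n - m) else 0 := by
    rw [Finset.mul_sum]
    refine Finset.sum_congr rfl fun m hm => ?_
    rw [hadd m hm]
    split_ifs <;> simp
  have hR : (∑ m ∈ below n, if IsSourceOf 0 m ∧ IsSourceOf (γ₁ + γ₂) (n - m) ∧
        (∃ q ∈ below (m + (n - m)), IsSourceOf γ₁ q) then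
        F (m + (n - m)) * (currentWeight β m * currentWeight β (n - m)) else 0) =
      F n * ((if ∃ q ∈ below n, IsSourceOf γ₁ q then 1 else 0) *
        ∑ m ∈ below n, if IsSourceOf 0 m ∧ IsSourceOf (γ₁ + γ₂) (n - m) then
          currentWeight β m * currentWeight β (n - m) else 0) := by
    rw [Finset.mul_sum, Finset.mul_sum]
    refine Finset.sum_congr rfl fun m hm => ?_
    rw [hadd m hm]
    by_cases hq : ∃ q ∈ below n, IsSourceOf γ₁ q
    · simp only [hq, and_true, if_true, one_mul]
      split_ifs <;> simp
    · simp only [hq, and_false, if_false, zero_mul, mul_zero]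
  rw [hL, hR, switching_fiber β γ₁ γ₂ n]
  split_ifs <;> simp

/-! ### Application: the square of the Wilson loop numerator (Proposition 6.1) -/

/-- The product of two current expansions as one absolutely convergent double series (`β ≥ 0`).
[cite: ForsstromViklund2025currents, Prop. 6.1 (proof)] -/
theorem tsum_mul_tsum_currents {β : ℝ} (hβ : 0 ≤ β) (γ₁ γ₂ : Site d L → Fin d → ZMod 2) :
    (∑' n : Current d L, (if IsSourceOf γ₁ n then currentWeight β n else 0)) *
        (∑' n : Current d L, (if IsSourceOf γ₂ n then currentWeight β n else 0)) =
      ∑' nn : Current d L × Current d L,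
        (if IsSourceOf γ₁ nn.1 ∧ IsSourceOf γ₂ nn.2 then
          currentWeight β nn.1 * currentWeight β nn.2 else 0) := by
  classical
  have hnorm : ∀ γ : Site d L → Fin d → ZMod 2,
      Summable (fun n : Current d L => ‖(if IsSourceOf γ n then currentWeight β n else 0)‖) := by
    intro γ
    refine Summable.of_nonneg_of_le (fun n => norm_nonneg _) (fun n => ?_)
      (summable_currentWeight (d := d) (L := L) β)
    split_ifs
    · rw [Real.norm_eq_abs, abs_of_nonneg (currentWeight_nonneg hβ _)]
    · rw [norm_zero]; exact currentWeight_nonneg hβ _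
  rw [tsum_mul_tsum_of_summable_norm (hnorm γ₁) (hnorm γ₂)]
  refine tsum_congr fun nn => ?_
  by_cases h1 : IsSourceOf γ₁ nn.1
  · by_cases h2 : IsSourceOf γ₂ nn.2
    · rw [if_pos h1, if_pos h2, if_pos ⟨h1, h2⟩]
    · rw [if_pos h1, if_neg h2, if_neg (fun h => h2 h.2), mul_zero]
  · rw [if_neg h1, zero_mul, if_neg (fun h => h1 h.1)]

/-- **Proposition 6.1 (Forsström–Viklund), PROVED on the torus**: for `β ≥ 0` and every loop `γ`,
`𝔼_{β}[W_γ]² = (Z_β[γ]/Z_β[0])² =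
  Σ_{n₁,n₂∈𝒞_0} w(n₁)w(n₂) 𝟙(∃ q ∈ 𝒞_γ : q ≤ n₁+n₂) / Σ_{n₁,n₂∈𝒞_0} w(n₁)w(n₂)` — the square of
the Wilson loop expectation is the probability, under the doubled random-current measure with empty
sources, that the total current contains a current with source `γ` (proof as printed: Theorem 1.1
twice and the switching lemma with `F = 1`, `γ₁ = γ₂ = γ`, `γ + γ = 0`).
[cite: ForsstromViklund2025currents, Prop. 6.1] -/
theorem wilson_sq_eq_doubleCurrent {β : ℝ} (hβ : 0 ≤ β) (γ : Site d L → Fin d → ZMod 2) :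
    (loopNumerator β γ / loopNumerator (d := d) (L := L) β 0) ^ 2 =
      (∑' nn : Current d L × Current d L,
          (if IsSourceOf 0 nn.1 ∧ IsSourceOf 0 nn.2 ∧ (∃ q ∈ below (nn.1 + nn.2), IsSourceOf γ q) then
            currentWeight β nn.1 * currentWeight β nn.2 else 0)) /
        ∑' nn : Current d L × Current d L,
          (if IsSourceOf 0 nn.1 ∧ IsSourceOf 0 nn.2 then
            currentWeight β nn.1 * currentWeight β nn.2 else 0) := by
  classical
  set K : ℝ := (Fintype.card (Site d L → Fin d → ZMod 2) : ℝ) with hK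
  have hK0 : K ≠ 0 := by rw [hK]; exact_mod_cast Fintype.card_ne_zero
  have hγγ : γ + γ = 0 := by
    funext x k
    exact (by decide : ∀ a : ZMod 2, a + a = 0) _
  -- numerator: Thm 1.1 twice, then the switching lemma with `F = 1`
  have hnum : loopNumerator β γ ^ 2 = K ^ 2 *
      ∑' nn : Current d L × Current d L,
        (if IsSourceOf 0 nn.1 ∧ IsSourceOf 0 nn.2 ∧ (∃ q ∈ below (nn.1 + nn.2), IsSourceOf γ q) then
          currentWeight β nn.1 * currentWeight β nn.2 else 0) := by
    rw [loopNumerator_eq_tsum, ← hK, mul_pow, sq (∑' n : Current d L, _),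
      tsum_mul_tsum_currents hβ γ γ]
    have hsw := switching_lemma hβ (fun _ => (1 : ℝ)) (M := 1) (fun _ => by simp) γ γ
    simp only [one_mul] at hsw
    rw [hsw, hγγ]
  have hden : loopNumerator (d := d) (L := L) β 0 ^ 2 = K ^ 2 *
      ∑' nn : Current d L × Current d L,
        (if IsSourceOf 0 nn.1 ∧ IsSourceOf 0 nn.2 then
          currentWeight β nn.1 * currentWeight β nn.2 else 0) := by
    rw [loopNumerator_eq_tsum, ← hK, mul_pow, sq (∑' n : Current d L, _),
      tsum_mul_tsum_currents hβ 0 0]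
  rw [div_pow, hnum, hden, mul_div_mul_left _ _ (pow_ne_zero 2 hK0)]

/-! ### Applications: positivity and Griffiths' second inequality via switching (Props. 6.2, 6.3) -/

/-- The current expansion is a series of non-negative terms (`β ≥ 0`). [cite: ForsstromViklund2025currents, Prop. 6.2 (proof)] -/
theorem tsum_currents_nonneg {β : ℝ} (hβ : 0 ≤ β) (γ : Site d L → Fin d → ZMod 2) :
    0 ≤ ∑' n : Current d L, (if IsSourceOf γ n then currentWeight β n else 0) :=
  tsum_nonneg fun n => by
    split_ifs
    · exact currentWeight_nonneg hβ _
    · exact le_rfl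

/-- **Proposition 6.2 (non-negativity) via the current expansion**: `Z_β[γ] ≥ 0` for `β ≥ 0`.
[cite: ForsstromViklund2025currents, Prop. 6.2] -/
theorem loopNumerator_nonneg {β : ℝ} (hβ : 0 ≤ β) (γ : Site d L → Fin d → ZMod 2) :
    0 ≤ loopNumerator β γ := by
  rw [loopNumerator_eq_tsum]
  exact mul_nonneg (Nat.cast_nonneg _) (tsum_currents_nonneg hβ γ)

/-- `Z_β[0] > 0` (the partition function). [cite: ForsstromViklund2025currents, §1.1 (Z_{β,N}[0])] -/
theorem loopNumerator_zero_pos (β : ℝ) : 0 < loopNumerator (d := d) (L := L) β 0 := by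
  unfold loopNumerator
  refine Finset.sum_pos (fun θ _ => ?_) Finset.univ_nonempty
  have h1 : wilsonSign (0 : Site d L → Fin d → ZMod 2) θ = 1 := by
    simp [wilsonSign, pairing, spin]
  rw [h1, one_mul]
  exact Real.exp_pos _

/-- **Griffiths' second inequality for the numerators, by switching** (the printed proof of
Prop. 6.3(i)): `Z_β[γ₁] Z_β[γ₂] ≤ Z_β[0] Z_β[γ₁+γ₂]` for `β ≥ 0` — the switched double series is the
unswitched one times an indicator. [cite: ForsstromViklund2025currents, Prop. 6.3 (proof)] -/
theorem loopNumerator_mul_le {β : ℝ} (hβ : 0 ≤ β) (γ₁ γ₂ : Site d L → Fin d → ZMod 2) :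
    loopNumerator β γ₁ * loopNumerator β γ₂ ≤
      loopNumerator (d := d) (L := L) β 0 * loopNumerator β (γ₁ + γ₂) := by
  set K : ℝ := (Fintype.card (Site d L → Fin d → ZMod 2) : ℝ) with hK
  have hK0 : 0 ≤ K := by rw [hK]; exact Nat.cast_nonneg _
  rw [loopNumerator_eq_tsum, loopNumerator_eq_tsum, loopNumerator_eq_tsum β 0,
    loopNumerator_eq_tsum β (γ₁ + γ₂), ← hK]
  rw [mul_mul_mul_comm, mul_mul_mul_comm K _ K, tsum_mul_tsum_currents hβ γ₁ γ₂,
    tsum_mul_tsum_currents hβ 0 (γ₁ + γ₂)]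
  refine mul_le_mul_of_nonneg_left ?_ (mul_nonneg hK0 hK0)
  have hsw := switching_lemma hβ (fun _ => (1 : ℝ)) (M := 1) (fun _ => by simp) γ₁ γ₂
  simp only [one_mul] at hsw
  rw [hsw]
  have hs1 : Summable (fun nn : Current d L × Current d L =>
      if IsSourceOf 0 nn.1 ∧ IsSourceOf (γ₁ + γ₂) nn.2 ∧ (∃ q ∈ below (nn.1 + nn.2), IsSourceOf γ₁ q)
      then currentWeight β nn.1 * currentWeight β nn.2 else 0) := by
    have h := summable_switch hβ (fun _ => (1 : ℝ)) (M := 1) (fun _ => by simp)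
      (fun nn : Current d L × Current d L => IsSourceOf 0 nn.1 ∧ IsSourceOf (γ₁ + γ₂) nn.2 ∧
        ∃ q ∈ below (nn.1 + nn.2), IsSourceOf γ₁ q)
    simpa only [one_mul] using h
  have hs2 : Summable (fun nn : Current d L × Current d L =>
      if IsSourceOf 0 nn.1 ∧ IsSourceOf (γ₁ + γ₂) nn.2
      then currentWeight β nn.1 * currentWeight β nn.2 else 0) := by
    have h := summable_switch hβ (fun _ => (1 : ℝ)) (M := 1) (fun _ => by simp)
      (fun nn : Current d L × Current d L => IsSourceOf 0 nn.1 ∧ IsSourceOf (γ₁ + γ₂) nn.2)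
    simpa only [one_mul] using h
  refine Summable.tsum_le_tsum (fun nn => ?_) hs1 hs2
  have hww : 0 ≤ currentWeight β nn.1 * currentWeight β nn.2 :=
    mul_nonneg (currentWeight_nonneg hβ _) (currentWeight_nonneg hβ _)
  by_cases h : IsSourceOf 0 nn.1 ∧ IsSourceOf (γ₁ + γ₂) nn.2
  · rw [if_pos h]
    split_ifs
    · exact le_rfl
    · exact hww
  · rw [if_neg h, if_neg (fun h' => h ⟨h'.1, h'.2.1⟩)]

/-- **Proposition 6.3(i) (Griffiths' second inequality) for Ising lattice gauge theory on `𝕋^d_L`,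
by the random-current route**: `𝔼_β[W_{γ₁}] 𝔼_β[W_{γ₂}] ≤ 𝔼_β[W_{γ₁+γ₂}] = 𝔼_β[W_{γ₁} W_{γ₂}]`
(`β ≥ 0`; `𝔼_β[W_γ] = Z_β[γ]/Z_β[0]`). [cite: ForsstromViklund2025currents, Prop. 6.3] -/
theorem wilsonExpect_mul_le {β : ℝ} (hβ : 0 ≤ β) (γ₁ γ₂ : Site d L → Fin d → ZMod 2) :
    (loopNumerator β γ₁ / loopNumerator (d := d) (L := L) β 0) *
        (loopNumerator β γ₂ / loopNumerator (d := d) (L := L) β 0) ≤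
      loopNumerator β (γ₁ + γ₂) / loopNumerator (d := d) (L := L) β 0 := by
  have hZ := loopNumerator_zero_pos (d := d) (L := L) β
  rw [div_mul_div_comm, div_le_div_iff₀ (mul_pos hZ hZ) hZ]
  calc loopNumerator β γ₁ * loopNumerator β γ₂ * loopNumerator β 0
      ≤ loopNumerator β 0 * loopNumerator β (γ₁ + γ₂) * loopNumerator β 0 :=
        mul_le_mul_of_nonneg_right (loopNumerator_mul_le hβ γ₁ γ₂) hZ.le
    _ = loopNumerator β (γ₁ + γ₂) * (loopNumerator β 0 * loopNumerator β 0) := by ring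

end IsingGaugeCurrents

end Literature.MathematicalPhysics.QuantumFieldTheory
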